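/-
Copyright (c) 2026 the pub-hodgecm-mathlib formalisation cell (harness21).  Prover seat hodgecm-mathlib-F0P2-p10 (g4), Track B ∕ R90-TF, h413 = `stmt-HodgeConjecture-24833`,
R90-TF section S8 «ContSpec-n½», socket (E) `sock_S8_res_exhaustion_le_closure` (B ED. 7 :276) via ★ `res_exhaustion_le_closure_of_record`: the `hScP` row of the E1 Plancherel estate's
bill FOR THE τ-CUT BLOCK and the τ-cut projector `Pr_τ = e_τ ∘L R_f(e)` (S8 dealer R90-CS-plan (g3) S8-R243; census `K2/K2E1-p14/g4/CENSUS-E4-PlancherelEstate.K2E1-p14-g4.md` item (2);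
K-TYPE CURRENCY FLAG S8-R189: the (N₃) row is paid PER `K_∞`-TYPE τ; `e_τ` hypothesis-first in K2E1-p16 (g4)'s `R90S8ResGIsotypicTauIdempotentModelU3` shape).
-/
import Summits.HodgeConjecture.HodgeConjecture.Theorems.R90S8ResGBlockFixedByProjectorU3     -- ★ (K2E1-p14 (g4)): `integratedOperator_fin_apply_eq_self_of_mem_resGBlock` (finite-level half, PAID), `hScP_of_archFix`; brings ★ `resGBlock_finLevel_le_fix`, ★ G-DEFS `resGBlock`
import Mathlib.Algebra.Group.Idempotent                                                    -- Mathlib `IsIdempotentElem.mul_of_commute`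
import HarnessLib

/-!
# S8 (E) road — `R90S8ResGBlockProjectorFixTauU3`: the `hScP` row for the τ-CUT block — the τ-cut projector `Pr_τ = e_τ ∘L R_f(e)` FIXES `Sc(ι_f Kf, 1; χ₁, χ₂) ⊓ N_τ`

Track B ∕ R90-TF, crux h413 = `stmt-HodgeConjecture-24833`, route of record `HCCMUnconditional`; cell `hodgecm-mathlib`, R90-TF programme, section S8 «ContSpec-n½», socket (E)
(B ED. 7 :276) through ★ `res_exhaustion_le_closure_of_record` ∕ ★ `hNblk_of_record` ∕ ★ `hNblk_of_kTypes` (K2E1-p14): the (N₃) row is PAID PER `K_∞`-TYPE `τ` (S8-R189).  For a type of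
dimension `> 1` the D5′ block projector is the τ-CUT PROJECTOR `Pr_τ = e_τ ∘L R_f(e)` — `e_τ` the `χ_τ`-IDEMPOTENT `dim τ • ∫_{K_∞} conj (χ_τ k) • R(k) dk` (K2E1-p16 (g4)'s
`R90S8ResGIsotypicTauIdempotentModelU3`, in flight: continuity, idempotence, range = the τ-isotypic component `N_τ`, commutation with `R_f(e)`), `e` a level kernel at the index of record `Kf`
(★ `exists_levelIdempotent_of_record`) — and the per-τ bill carries `hScP : Sc_τ ≤ Fix(Pr_τ)` for the τ-CUT BLOCK `Sc_τ := Sc(ι_f Kf, 1; χ₁, χ₂) ⊓ N_τ` (the `hcut` granularity of ★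
`R90S8ResGIsotypicArchLevelBridgeU3`).  THIS FILE pays that row, with `e_τ` HYPOTHESIS-FIRST through the ONE property used — «`e_τ` is the identity on `N_τ`» (p16's range row) — in three
spellings: operator-abstract `e_τ`, the estate's `P ∕ hPdef` binder pair, and ★ `hScP_of_archFix`'s `π_K(χK)` spelling (`χK := dim τ • conj χ_τ ∈ C_c(K_∞, ℂ)`; no multiplicativity).  THEOREMS
ONLY (no `def`, no `instance`, no `notation`, no named-fact hypothesis, no `sorry`; default heartbeats); lane `--supports stmt-HodgeConjecture-24833 --as helper` (count-neutral).  CLOSES NO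
SOCKET.

THE MATHEMATICS ([BorelJacquet1979, §4.1, §4.6]; [MoeglinWaldspurger1995, II.1.5]; [DeitmarEchterhoff2014, Lemma 1.6.3, Prop. 7.3.3]).  For `x ∈ Sc_τ = Sc ⊓ N_τ`: `R_f(e) x = x` because
`Sc = Sc(ι_f Kf, 1; χ₁, χ₂)` lies in `Fix(ι_f Kf)` at the index of record and `e` is a level kernel there (★ `integratedOperator_fin_apply_eq_self_of_mem_resGBlock` — the finite-level half,
PAID), and then `e_τ x = x` because `x ∈ N_τ` and `e_τ` is the identity on `N_τ`; so `Pr_τ x = e_τ (R_f(e) x) = x`.  The `hPV`-type bookkeeping of the τ-edition of D5′ (`Pr_τ` idempotent,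
`Pr_τ y ∈ Fix(Pr_τ)`) is the product of two COMMUTING idempotents (Mathlib `IsIdempotentElem.mul_of_commute`) — §1, generic.
* §1 GENERIC (any `ℂ`-module, continuous linear maps): `inf_le_eqLocus_comp_of_forall_apply_eq` (two operators each fixing one subspace ⇒ the composite fixes the intersection);
  `isIdempotentElem_comp_of_commute`, `apply_mem_eqLocus_of_isIdempotentElem`, `eqLocus_inf_eqLocus_le_eqLocus_comp` (the `hPV` ∕ `V_P` bookkeeping for a product of commuting idempotents).
* §2 AT THE BLOCK OF RECORD `Sc = resGBlock L μ (ι_f Kf) 1 χ₁ χ₂` (`Kf` open `≤ K₀`, `χ₂` automorphic, `e` a level kernel at `Kf`): **`hScP_tauCut_of_fix`** (operator-abstract `e_τ : L² →L L²`,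
  `N ≤ Fix(e_τ)` ⊢ `Sc ⊓ N ≤ Fix(e_τ ∘L R_f(e))`); **`hScP_tauCut_of_hPdef`** (the estate's binder pair `P`, `hPdef : P = e_τ ∘L R_f(e)`); **`hScP_tauCut_of_record`** (★ `hScP_of_archFix`'s
  spelling `Pr_τ = π_K(χK) ∘L R_f(e)` for any compact `κ : K →* G_∞` and kernel `χK ∈ C_c(K, ℂ)`, e.g. `K := K_∞` of record, `χK := dim τ • conj χ_τ`; hypothesis `π_K(χK)` = identity on `N`).
HONEST LABEL: HC_CM is proved only modulo the 7 printed citations (2 remaining named inputs: hLiu418 = `stmt-HodgeConjecture-24832`, h413 = `stmt-HodgeConjecture-24833`) until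
rung 0 closes; REL ≠ ★ ≠ BUILT; this file asserts no named fact, is conditional on its visible binder («`e_τ` fixes `N_τ`», K2E1-p16's range row), and closes no socket; (E) :276 stays ★ OF
RECORD modulo {(HEAD₃) L, E1-Plancherel XL, per-block glue} — unchanged; count-neutral.

## References
* [BorelJacquet1979] A. Borel, H. Jacquet, *Automorphic forms and automorphic representations*, PSPM 33.1 (1979), §4.1, §4.6.
* [MoeglinWaldspurger1995] C. Mœglin, J.-L. Waldspurger, *Spectral Decomposition and Eisenstein Series* (1995), II.1.5.
* [DeitmarEchterhoff2014] A. Deitmar, S. Echterhoff, *Principles of Harmonic Analysis* (2nd ed., 2014), Lemma 1.6.3, Prop. 7.3.3.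
-/

set_option autoImplicit false
set_option linter.dupNamespace false  -- the mandated namespace `…HodgeConjecture.HodgeConjecture.R90.S8` (LEAD #1 L1) repeats the summit's segment

noncomputable section

open MeasureTheory Filter Topology CompactlySupported NumberField ContRepresentation Set
open scoped InnerProductSpace ENNReal NNReal ComplexConjugate
open Literature.NumberTheory.Automorphic Literature.NumberTheory.Automorphic.UnitaryGroup Literature.NumberTheory.GaloisRepresentations AdelicGroupData
open Literature.NumberTheory.Automorphic.Arthur2013.Leaves.TECR

namespace Summit.HodgeConjecture.HodgeConjecture.R90.S8

/-! ## §1 Generic: composites of operators fixing subspaces; products of commuting idempotents -/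

section Generic

variable {V : Type*} [AddCommGroup V] [Module ℂ V] [TopologicalSpace V]

/-- **A COMPOSITE FIXES THE INTERSECTION**: if `B` is the identity on `S` and `A` is the identity on `N`, then `A ∘L B` is the identity on `S ⊓ N` — `S ⊓ N ≤ Fix(A ∘L B)` in the estate's
`LinearMap.eqLocus … LinearMap.id` spelling. [cite: DeitmarEchterhoff2014, Lemma 1.6.3] -/
theorem inf_le_eqLocus_comp_of_forall_apply_eq (A B : V →L[ℂ] V) (S N : Submodule ℂ V) (hB : ∀ x ∈ S, B x = x) (hA : ∀ x ∈ N, A x = x) :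
    S ⊓ N ≤ LinearMap.eqLocus ((A ∘L B : V →L[ℂ] V) : V →ₗ[ℂ] V) LinearMap.id := by
  rintro x ⟨hxS, hxN⟩
  rw [LinearMap.mem_eqLocus, LinearMap.id_apply, ContinuousLinearMap.coe_coe, ContinuousLinearMap.comp_apply, hB x hxS]
  exact hA x hxN

/-- **THE PRODUCT OF TWO COMMUTING IDEMPOTENTS IS AN IDEMPOTENT** (Mathlib `IsIdempotentElem.mul_of_commute`, read for `∘L`): the τ-cut projector `Pr_τ = e_τ ∘L R_f(e)` is idempotent as
soon as `e_τ` and `R_f(e)` are and commute (K2E1-p16's idempotence and commutation rows). [cite: DeitmarEchterhoff2014, Prop. 7.3.3] -/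
theorem isIdempotentElem_comp_of_commute {A B : V →L[ℂ] V} (hA : IsIdempotentElem A) (hB : IsIdempotentElem B) (hAB : Commute A B) : IsIdempotentElem (A ∘L B) :=
  hA.mul_of_commute hAB hB

/-- **`hPV` for an idempotent**: `P y ∈ Fix(P)` for every `y`. [cite: DeitmarEchterhoff2014, Prop. 7.3.3] -/
theorem apply_mem_eqLocus_of_isIdempotentElem {P : V →L[ℂ] V} (hP : IsIdempotentElem P) (y : V) : P y ∈ LinearMap.eqLocus (P : V →ₗ[ℂ] V) LinearMap.id := by
  rw [LinearMap.mem_eqLocus, LinearMap.id_apply, ContinuousLinearMap.coe_coe]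
  have h : P ∘L P = P := by rw [← ContinuousLinearMap.mul_def]; exact hP.eq
  have h' := congrArg (fun T : V →L[ℂ] V => T y) h
  simpa only [ContinuousLinearMap.comp_apply] using h'

/-- **`Fix(A) ⊓ Fix(B) ≤ Fix(A ∘L B)`** (no commutation needed in this direction). [cite: DeitmarEchterhoff2014, Lemma 1.6.3] -/
theorem eqLocus_inf_eqLocus_le_eqLocus_comp (A B : V →L[ℂ] V) :
    LinearMap.eqLocus (A : V →ₗ[ℂ] V) LinearMap.id ⊓ LinearMap.eqLocus (B : V →ₗ[ℂ] V) LinearMap.id ≤ LinearMap.eqLocus ((A ∘L B : V →L[ℂ] V) : V →ₗ[ℂ] V) LinearMap.id := by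
  intro x hx
  obtain ⟨hxA, hxB⟩ := Submodule.mem_inf.1 hx
  rw [LinearMap.mem_eqLocus, LinearMap.id_apply, ContinuousLinearMap.coe_coe] at hxA hxB
  rw [LinearMap.mem_eqLocus, LinearMap.id_apply, ContinuousLinearMap.coe_coe, ContinuousLinearMap.comp_apply, hxB, hxA]

/-- **`Fix(A ∘L B) ≤ Fix(A)` for an idempotent `A`**: if `A (B x) = x` then `A x = A (A (B x)) = A (B x) = x`.  With the symmetric statement this gives `Fix(e_τ ∘L R_f(e)) = Fix(e_τ) ⊓ Fix(R_f(e))`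
for the τ-cut projector (K2E1-p16's idempotence and commutation rows). [cite: DeitmarEchterhoff2014, Prop. 7.3.3] -/
theorem eqLocus_comp_le_eqLocus_left {A B : V →L[ℂ] V} (hA : IsIdempotentElem A) :
    LinearMap.eqLocus ((A ∘L B : V →L[ℂ] V) : V →ₗ[ℂ] V) LinearMap.id ≤ LinearMap.eqLocus (A : V →ₗ[ℂ] V) LinearMap.id := by
  intro x hx
  rw [LinearMap.mem_eqLocus, LinearMap.id_apply, ContinuousLinearMap.coe_coe, ContinuousLinearMap.comp_apply] at hx
  rw [LinearMap.mem_eqLocus, LinearMap.id_apply, ContinuousLinearMap.coe_coe]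
  have hAA : A ∘L A = A := by rw [← ContinuousLinearMap.mul_def]; exact hA.eq
  have h : A (A (B x)) = A (B x) := by
    have h' := congrArg (fun T : V →L[ℂ] V => T (B x)) hAA
    simpa only [ContinuousLinearMap.comp_apply] using h'
  rw [hx] at h
  exact h

/-- **`Fix(A ∘L B) ≤ Fix(B)` for an idempotent `B` commuting with `A`** (`A ∘L B = B ∘L A`, then the previous lemma). [cite: DeitmarEchterhoff2014, Prop. 7.3.3] -/
theorem eqLocus_comp_le_eqLocus_right {A B : V →L[ℂ] V} (hB : IsIdempotentElem B) (hAB : Commute A B) :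
    LinearMap.eqLocus ((A ∘L B : V →L[ℂ] V) : V →ₗ[ℂ] V) LinearMap.id ≤ LinearMap.eqLocus (B : V →ₗ[ℂ] V) LinearMap.id := by
  have h : A ∘L B = B ∘L A := by rw [← ContinuousLinearMap.mul_def, ← ContinuousLinearMap.mul_def]; exact hAB.eq
  rw [h]
  exact eqLocus_comp_le_eqLocus_left hB

end Generic

/-! ## §2 At the block of record: the τ-cut projector fixes the τ-cut block -/

section Record

variable (L : Type) [Field L] [NumberField L] [IsCMField L]
  (μ : Measure (quasiSplit (↥(maximalRealSubfield L)) L (IsCMField.complexConj L) 3).automorphicQuotient) [(quasiSplit (↥(maximalRealSubfield L)) L (IsCMField.complexConj L) 3).IsAutomorphicMeasure μ]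
  [MeasurableSpace (finAdelic (↥(maximalRealSubfield L)) L (IsCMField.complexConj L) 3 ((StdForm.antidiagonal 3).over L))] [BorelSpace (finAdelic (↥(maximalRealSubfield L)) L (IsCMField.complexConj L) 3 ((StdForm.antidiagonal 3).over L))]
  (νf : Measure (finAdelic (↥(maximalRealSubfield L)) L (IsCMField.complexConj L) 3 ((StdForm.antidiagonal 3).over L))) [IsFiniteMeasureOnCompacts νf]

/-- **`hScP` FOR THE τ-CUT BLOCK, OPERATOR-ABSTRACT `e_τ`**: at the block of record `Sc = resGBlock L μ (ι_f Kf) 1 χ₁ χ₂` (`Kf` open `≤ K₀`, `χ₂` automorphic) with a level kernel `e` at `Kf`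
(`he0 he1`) and ANY continuous linear `e_τ` on `L²` which is the identity on a subspace `N` (K2E1-p16's range row: `N = N_τ`, the τ-isotypic component, `e_τ` the `χ_τ`-idempotent), the τ-cut
projector `e_τ ∘L R_f(e)` fixes the τ-cut block: `Sc ⊓ N ≤ Fix(e_τ ∘L R_f(e))` — `R_f(e) x = x` on `Sc` (★ `integratedOperator_fin_apply_eq_self_of_mem_resGBlock`), then `e_τ x = x` on `N`.
[cite: BorelJacquet1979, §4.1, §4.6] [cite: MoeglinWaldspurger1995, II.1.5] -/
theorem hScP_tauCut_of_fix (Kf : {Kf : Subgroup ↥(finAdelic (↥(maximalRealSubfield L)) L (IsCMField.complexConj L) 3 ((StdForm.antidiagonal 3).over L)) // IsOpen ((Kf : Subgroup ↥(finAdelic (↥(maximalRealSubfield L)) L (IsCMField.complexConj L) 3 ((StdForm.antidiagonal 3).over L))) : Set ↥(finAdelic (↥(maximalRealSubfield L)) L (IsCMField.complexConj L) 3 ((StdForm.antidiagonal 3).over L))) ∧ Kf ≤ ((((standardMaximalCompactGL 3 L).comap (adelicVal (↥(maximalRealSubfield L)) L (IsCMField.complexConj L) 3 ((StdForm.antidiagonal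 3).over L)) : Subgroup (quasiSplit (↥(maximalRealSubfield L)) L (IsCMField.complexConj L) 3).Adelic)).comap (finAdelicToAdelic (↥(maximalRealSubfield L)) L (IsCMField.complexConj L) 3 ((StdForm.antidiagonal 3).over L)) : Subgroup ↥(finAdelic (↥(maximalRealSubfield L)) L (IsCMField.complexConj L) 3 ((StdForm.antidiagonal 3).over L)))})
    (e : C_c(finAdelic (↥(maximalRealSubfield L)) L (IsCMField.complexConj L) 3 ((StdForm.antidiagonal 3).over L), ℂ)) (he0 : ∀ x : finAdelic (↥(maximalRealSubfield L)) L (IsCMField.complexConj L) 3 ((StdForm.antidiagonal 3).over L), x ∉ Kf.1 → e x = 0) (he1 : ∫ x, e x ∂νf = 1)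
    (χ₁ : HeckeCharacter L) {χ₂ : ↥(TorusDict.torus (IsCMField.complexConj L)) →ₜ* ℂˣ} (hχ₂ : TorusDict.IsAutomorphic (IsCMField.complexConj L) χ₂)
    (eτ : (quasiSplit (↥(maximalRealSubfield L)) L (IsCMField.complexConj L) 3).L2 μ →L[ℂ] (quasiSplit (↥(maximalRealSubfield L)) L (IsCMField.complexConj L) 3).L2 μ) (N : Submodule ℂ ((quasiSplit (↥(maximalRealSubfield L)) L (IsCMField.complexConj L) 3).L2 μ)) (hN : ∀ x ∈ N, eτ x = x) :
    resGBlock L μ (Kf.1.map (finAdelicToAdelic (↥(maximalRealSubfield L)) L (IsCMField.complexConj L) 3 ((StdForm.antidiagonal 3).over L))) 1 χ₁ χ₂ ⊓ N ≤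
      LinearMap.eqLocus ((eτ ∘L (((quasiSplit (↥(maximalRealSubfield L)) L (IsCMField.complexConj L) 3).rightRegular μ).restrict (finAdelicToAdelic (↥(maximalRealSubfield L)) L (IsCMField.complexConj L) 3 ((StdForm.antidiagonal 3).over L))).integratedOperator (((quasiSplit (↥(maximalRealSubfield L)) L (IsCMField.complexConj L) 3).isUnitary_rightRegular μ).restrict _) (((quasiSplit (↥(maximalRealSubfield L)) L (IsCMField.complexConj L) 3).isStronglyContinuous_rightRegular_holds μ).restrict _ (continuous_finAdelicToAdelic (↥(maximalRealSubfield L)) L (IsCMField.complexConj L) 3 ((StdForm.antidiagonal 3).over L))) νf e : (quasiSplit (↥(maximalRealSubfield L)) L (IsCMField.complexConj L) 3).L2 μ →L[ℂ] (quasiSplit (↥(maximalRealSubfield L)) L (IsCMField.complexConj L) 3).L2 μ) : (quasiSplit (↥(maximalRealSubfield L)) L (IsCMField.complexConj L) 3).L2 μ →ₗ[ℂ] (quasiSplit (↥(maximalRealSubfield L)) L (IsCMField.complexConj L) 3).L2 μ) LinearMap.id :=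
  inf_le_eqLocus_comp_of_forall_apply_eq _ _ _ _ (fun _ hx => integratedOperator_fin_apply_eq_self_of_mem_resGBlock L μ νf Kf e he0 he1 χ₁ hχ₂ hx) hN

/-- **`hScP` FOR THE τ-CUT BLOCK IN THE ESTATE'S `P ∕ hPdef` BINDER PAIR**: with `hPdef : P = e_τ ∘L R_f(e)` (the τ-edition of D5′'s projector binder), `Sc ⊓ N ≤ LinearMap.eqLocus P id`.
[cite: BorelJacquet1979, §4.1, §4.6] [cite: MoeglinWaldspurger1995, II.1.5] -/
theorem hScP_tauCut_of_hPdef (Kf : {Kf : Subgroup ↥(finAdelic (↥(maximalRealSubfield L)) L (IsCMField.complexConj L) 3 ((StdForm.antidiagonal 3).over L)) // IsOpen ((Kf : Subgroup ↥(finAdelic (↥(maximalRealSubfield L)) L (IsCMField.complexConj L) 3 ((StdForm.antidiagonal 3).over L))) : Set ↥(finAdelic (↥(maximalRealSubfield L)) L (IsCMField.complexConj L) 3 ((StdForm.antidiagonal 3).over L))) ∧ Kf ≤ ((((standardMaximalCompactGL 3 L).comap (adelicVal (↥(maximalRealSubfield L)) L (IsCMField.complexConj L) 3 ((StdForm.antidiagonal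 3).over L)) : Subgroup (quasiSplit (↥(maximalRealSubfield L)) L (IsCMField.complexConj L) 3).Adelic)).comap (finAdelicToAdelic (↥(maximalRealSubfield L)) L (IsCMField.complexConj L) 3 ((StdForm.antidiagonal 3).over L)) : Subgroup ↥(finAdelic (↥(maximalRealSubfield L)) L (IsCMField.complexConj L) 3 ((StdForm.antidiagonal 3).over L)))})
    (e : C_c(finAdelic (↥(maximalRealSubfield L)) L (IsCMField.complexConj L) 3 ((StdForm.antidiagonal 3).over L), ℂ)) (he0 : ∀ x : finAdelic (↥(maximalRealSubfield L)) L (IsCMField.complexConj L) 3 ((StdForm.antidiagonal 3).over L), x ∉ Kf.1 → e x = 0) (he1 : ∫ x, e x ∂νf = 1)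
    (χ₁ : HeckeCharacter L) {χ₂ : ↥(TorusDict.torus (IsCMField.complexConj L)) →ₜ* ℂˣ} (hχ₂ : TorusDict.IsAutomorphic (IsCMField.complexConj L) χ₂)
    (eτ : (quasiSplit (↥(maximalRealSubfield L)) L (IsCMField.complexConj L) 3).L2 μ →L[ℂ] (quasiSplit (↥(maximalRealSubfield L)) L (IsCMField.complexConj L) 3).L2 μ) (N : Submodule ℂ ((quasiSplit (↥(maximalRealSubfield L)) L (IsCMField.complexConj L) 3).L2 μ)) (hN : ∀ x ∈ N, eτ x = x)
    (P : (quasiSplit (↥(maximalRealSubfield L)) L (IsCMField.complexConj L) 3).L2 μ →L[ℂ] (quasiSplit (↥(maximalRealSubfield L)) L (IsCMField.complexConj L) 3).L2 μ) (hPdef : P = eτ ∘L (((quasiSplit (↥(maximalRealSubfield L)) L (IsCMField.complexConj L) 3).rightRegular μ).restrict (finAdelicToAdelic (↥(maximalRealSubfield L)) L (IsCMField.complexConj L) 3 ((StdForm.antidiagonal 3).over L))).integratedOperator (((quasiSplit (↥(maximalRealSubfield L)) L (IsCMField.complexConj L) 3).isUnitary_rightRegular μ).restrict _) (((quasiSplit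 (↥(maximalRealSubfield L)) L (IsCMField.complexConj L) 3).isStronglyContinuous_rightRegular_holds μ).restrict _ (continuous_finAdelicToAdelic (↥(maximalRealSubfield L)) L (IsCMField.complexConj L) 3 ((StdForm.antidiagonal 3).over L))) νf e) :
    resGBlock L μ (Kf.1.map (finAdelicToAdelic (↥(maximalRealSubfield L)) L (IsCMField.complexConj L) 3 ((StdForm.antidiagonal 3).over L))) 1 χ₁ χ₂ ⊓ N ≤ LinearMap.eqLocus (P : (quasiSplit (↥(maximalRealSubfield L)) L (IsCMField.complexConj L) 3).L2 μ →ₗ[ℂ] (quasiSplit (↥(maximalRealSubfield L)) L (IsCMField.complexConj L) 3).L2 μ) LinearMap.id := by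
  subst hPdef
  exact hScP_tauCut_of_fix L μ νf Kf e he0 he1 χ₁ hχ₂ eτ N hN

/-- **`hScP_tauCut_of_record` — THE τ-CUT ROW IN ★ `hScP_of_archFix`'s SPELLING**: `Pr_τ = π_K(χK) ∘L R_f(e)` with `π_K(χK)` the integrated operator of `R ∘ ι_∞ ∘ κ` over a compact
`κ : K →* G_∞` against a Haar-type `μK` and ANY kernel `χK ∈ C_c(K, ℂ)` (for the τ-cut: `K := K_∞` of record, `χK := dim τ • conj χ_τ`, so that `π_K(χK) = e_τ`; no multiplicativity is
used); if `π_K(χK)` is the identity on `N` (p16's range row at `N = N_τ`), then the τ-cut block satisfies `Sc ⊓ N ≤ LinearMap.eqLocus Pr_τ id` — ★ `hScP_of_archFix` at the sub-block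
`Sc′ := Sc ⊓ N` with `hKfix` read off `hN`. [cite: BorelJacquet1979, §4.1, §4.6] [cite: MoeglinWaldspurger1995, II.1.5] [cite: DeitmarEchterhoff2014, Prop. 7.3.3] -/
theorem hScP_tauCut_of_record (Kf : {Kf : Subgroup ↥(finAdelic (↥(maximalRealSubfield L)) L (IsCMField.complexConj L) 3 ((StdForm.antidiagonal 3).over L)) // IsOpen ((Kf : Subgroup ↥(finAdelic (↥(maximalRealSubfield L)) L (IsCMField.complexConj L) 3 ((StdForm.antidiagonal 3).over L))) : Set ↥(finAdelic (↥(maximalRealSubfield L)) L (IsCMField.complexConj L) 3 ((StdForm.antidiagonal 3).over L))) ∧ Kf ≤ ((((standardMaximalCompactGL 3 L).comap (adelicVal (↥(maximalRealSubfield L)) L (IsCMField.complexConj L) 3 ((StdForm.antidiagonal 3).over L)) : Subgroup (quasiSplit (↥(maximalRealSubfield L)) L (IsCMField.complexConj L) 3).Adelic)).comap (finAdelicToAdelic (↥(maximalRealSubfield L)) L (IsCMField.complexConj L) 3 ((StdForm.antidiagonal 3).over L)) : Subgroup ↥(finAdelic (↥(maximalRealSubfield L)) L (IsCMField.complexConj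 L) 3 ((StdForm.antidiagonal 3).over L)))})
    (e : C_c(finAdelic (↥(maximalRealSubfield L)) L (IsCMField.complexConj L) 3 ((StdForm.antidiagonal 3).over L), ℂ)) (he0 : ∀ x : finAdelic (↥(maximalRealSubfield L)) L (IsCMField.complexConj L) 3 ((StdForm.antidiagonal 3).over L), x ∉ Kf.1 → e x = 0) (he1 : ∫ x, e x ∂νf = 1)
    (χ₁ : HeckeCharacter L) {χ₂ : ↥(TorusDict.torus (IsCMField.complexConj L)) →ₜ* ℂˣ} (hχ₂ : TorusDict.IsAutomorphic (IsCMField.complexConj L) χ₂)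
    {K : Type*} [Group K] [TopologicalSpace K] [MeasurableSpace K] [BorelSpace K]
    (κ : K →* UnitaryGroup.arch (↥(maximalRealSubfield L)) L (IsCMField.complexConj L) 3 ((StdForm.antidiagonal 3).over L)) (hκ : Continuous κ) (μK : Measure K) [IsFiniteMeasureOnCompacts μK] (χK : C_c(K, ℂ))
    (N : Submodule ℂ ((quasiSplit (↥(maximalRealSubfield L)) L (IsCMField.complexConj L) 3).L2 μ)) (hN : ∀ x ∈ N, (((quasiSplit (↥(maximalRealSubfield L)) L (IsCMField.complexConj L) 3).rightRegular μ).restrict ((archToAdelic (↥(maximalRealSubfield L)) L (IsCMField.complexConj L) 3 ((StdForm.antidiagonal 3).over L)).comp κ)).integratedOperator (((quasiSplit (↥(maximalRealSubfield L)) L (IsCMField.complexConj L) 3).isUnitary_rightRegular μ).restrict _)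
          (((quasiSplit (↥(maximalRealSubfield L)) L (IsCMField.complexConj L) 3).isStronglyContinuous_rightRegular_holds μ).restrict _ ((continuous_archToAdelic (↥(maximalRealSubfield L)) L (IsCMField.complexConj L) 3 ((StdForm.antidiagonal 3).over L)).comp hκ)) μK χK x = x) :
    resGBlock L μ (Kf.1.map (finAdelicToAdelic (↥(maximalRealSubfield L)) L (IsCMField.complexConj L) 3 ((StdForm.antidiagonal 3).over L))) 1 χ₁ χ₂ ⊓ N ≤
      LinearMap.eqLocus ((((((quasiSplit (↥(maximalRealSubfield L)) L (IsCMField.complexConj L) 3).rightRegular μ).restrict ((archToAdelic (↥(maximalRealSubfield L)) L (IsCMField.complexConj L) 3 ((StdForm.antidiagonal 3).over L)).comp κ)).integratedOperator (((quasiSplit (↥(maximalRealSubfield L)) L (IsCMField.complexConj L) 3).isUnitary_rightRegular μ).restrict _)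
          (((quasiSplit (↥(maximalRealSubfield L)) L (IsCMField.complexConj L) 3).isStronglyContinuous_rightRegular_holds μ).restrict _ ((continuous_archToAdelic (↥(maximalRealSubfield L)) L (IsCMField.complexConj L) 3 ((StdForm.antidiagonal 3).over L)).comp hκ)) μK χK ∘L
        (((quasiSplit (↥(maximalRealSubfield L)) L (IsCMField.complexConj L) 3).rightRegular μ).restrict (finAdelicToAdelic (↥(maximalRealSubfield L)) L (IsCMField.complexConj L) 3 ((StdForm.antidiagonal 3).over L))).integratedOperator (((quasiSplit (↥(maximalRealSubfield L)) L (IsCMField.complexConj L) 3).isUnitary_rightRegular μ).restrict _) (((quasiSplit (↥(maximalRealSubfield L)) L (IsCMField.complexConj L) 3).isStronglyContinuous_rightRegular_holds μ).restrict _ (continuous_finAdelicToAdelic (↥(maximalRealSubfield L)) L (IsCMField.complexConj L) 3 ((StdForm.antidiagonal 3).over L))) νf e) : (quasiSplit (↥(maximalRealSubfield L)) L (IsCMField.complexConj L) 3).L2 μ →L[ℂ] (quasiSplit (↥(maximalRealSubfield L)) L (IsCMField.complexConj L) 3).L2 μ) : (quasiSplit (↥(maximalRealSubfield L)) L (IsCMField.complexConj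 L) 3).L2 μ →ₗ[ℂ] (quasiSplit (↥(maximalRealSubfield L)) L (IsCMField.complexConj L) 3).L2 μ) LinearMap.id :=
  hScP_of_archFix L μ νf Kf e he0 he1 χ₁ hχ₂ κ hκ μK χK (resGBlock L μ (Kf.1.map (finAdelicToAdelic (↥(maximalRealSubfield L)) L (IsCMField.complexConj L) 3 ((StdForm.antidiagonal 3).over L))) 1 χ₁ χ₂ ⊓ N) inf_le_left fun x hx => hN x hx.2

end Record

end Summit.HodgeConjecture.HodgeConjecture.R90.S8

end
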